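import Literature.MathematicalPhysics.QuantumLattice.KohnLuttingerLindhardL2Bound
import Mathlib.MeasureTheory.Function.UniformIntegrable
import HarnessLib

/-!
# `L²`-continuity in `μ` of the Lindhard kernel along the moving Fermi curve, I: Minkowski and a.e.-`p` convergence

Topic `Literature/MathematicalPhysics/QuantumLattice`; continues `KohnLuttingerLindhardL2Bound`.
For `ε = squareDispersion 1 0` and levels in a compact sub-band `[μ₁, μ₂] ⊂ (-4, 0)`, GIVEN the torus
sublevel estimate (TSL) and the shell-volume estimate (SV) uniformly on `[μ₁, μ₂]`, the polar
Lindhard kernel `K_μ(θ,θ') = χ₀(γ_μθ + γ_μθ'; μ)` depends `L²(dθdθ')`-continuously on `μ`: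

* `unifIntegrable_of_dominated_rpow` — de la Vallée-Poussin: a family dominated by functions with
  uniformly bounded `∫ B^r` (`r > 1`) is uniformly integrable;
* `ae_integrable_lindhardIntegrand_polar` — for a.e. `(θ,θ')` the `p`-section of the polar
  Lindhard integrand is integrable over `BZ` (from `∫ (∫ F dp)² < ∞`);
* `eLpNorm_lindhardKernelPolar_sub_le` — Minkowski on the difference:
  `‖K_μ - K_μ₀‖₂ ≤ (2π)⁻² ∫_{BZ} ‖F_μ(·,p) - F_μ₀(·,p)‖_{L²(dθdθ')} dp`;
* `tendsto_eLpNorm_lindhardIntegrand_polar_sub` — for a.e. `p`, `‖F_μ(·,p) - F_μ₀(·,p)‖₂ → 0`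
  (dominated convergence in `(θ,θ')`; the integrand converges off the null set
  `{ε(p + γ₀θ + γ₀θ') = μ₀}`);
* the Vitali step in `p` and the conclusion (K2') are in `KohnLuttingerLindhardL2Vitali`.

Everything is proved; no definitions. [cite: SteinSingularIntegrals1970, App. A.1]
-/

noncomputable section

open Real Set Filter MeasureTheory MeasureTheory.Measure
open scoped Topology ENNReal NNReal

namespace Literature.MathematicalPhysics.QuantumLattice

/-! ### de la Vallée-Poussin: uniform integrability from a uniform `L^r` bound, `r > 1` -/

/-- **de la Vallée-Poussin criterion** (dominated form, `p = 1`): if `0 ≤ H i ≤ B i` a.e. and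
`∫ (B i)^r ≤ M₀ < ∞` for some `r > 1` uniformly in `i`, then `(H i)` is uniformly integrable.
[folklore] -/
theorem unifIntegrable_of_dominated_rpow {ι α : Type*} [MeasurableSpace α] {P : Measure α}
    {H B : ι → α → ℝ} (hHm : ∀ i, AEStronglyMeasurable (H i) P) (hH0 : ∀ i, ∀ᵐ x ∂P, 0 ≤ H i x)
    (hHB : ∀ i, ∀ᵐ x ∂P, H i x ≤ B i x) {r : ℝ} (hr : 1 < r) {M₀ : ℝ≥0∞} (hM₀ : M₀ ≠ ⊤)
    (hB : ∀ i, ∫⁻ x, ENNReal.ofReal (B i x ^ r) ∂P ≤ M₀) :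
    UnifIntegrable H 1 P := by
  set M : ℝ := M₀.toReal with hM
  have hB' : ∀ i, ∫⁻ x, ENNReal.ofReal (B i x ^ r) ∂P ≤ ENNReal.ofReal M := fun i => by
    rw [hM, ENNReal.ofReal_toReal hM₀]; exact hB i
  refine unifIntegrable_of le_rfl ENNReal.one_ne_top hHm fun e he => ?_
  -- choose `C ≥ 1` with `C^{1-r} M ≤ e`
  obtain ⟨C, hC1, hCM⟩ : ∃ C : ℝ, 1 ≤ C ∧ C ^ (1 - r) * M ≤ e := by
    have hlim : Tendsto (fun C : ℝ => C ^ (1 - r) * M) atTop (𝓝 (0 * M)) :=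
      (tendsto_rpow_neg_atTop (by linarith : 0 < r - 1)).congr (fun C => by
        rw [show -(r - 1) = 1 - r by ring]) |>.mul_const M
    rw [zero_mul] at hlim
    obtain ⟨C₀, hC₀⟩ := (hlim.eventually (Iic_mem_nhds he)).exists_forall_of_atTop
    exact ⟨max C₀ 1, le_max_right _ _, hC₀ _ (le_max_left _ _)⟩
  have hC0 : 0 < C := zero_lt_one.trans_le hC1
  refine ⟨⟨C, hC0.le⟩, fun i => ?_⟩
  rw [eLpNorm_one_eq_lintegral_enorm]
  -- on `{C ≤ |H|}`: `‖H‖ₑ ≤ C^{1-r} B^r`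
  have hpt : ∀ᵐ x ∂P, ‖{x | (⟨C, hC0.le⟩ : ℝ≥0) ≤ ‖H i x‖₊}.indicator (H i) x‖ₑ ≤
      ENNReal.ofReal (C ^ (1 - r)) * ENNReal.ofReal (B i x ^ r) := by
    filter_upwards [hH0 i, hHB i] with x h0 hB
    by_cases hx : x ∈ {x | (⟨C, hC0.le⟩ : ℝ≥0) ≤ ‖H i x‖₊}
    · rw [indicator_of_mem hx, Real.enorm_eq_ofReal h0, ← ENNReal.ofReal_mul (Real.rpow_nonneg hC0.le _)]
      refine ENNReal.ofReal_le_ofReal ?_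
      have hCH : C ≤ H i x := by
        have h : ((⟨C, hC0.le⟩ : ℝ≥0) : ℝ) ≤ ((‖H i x‖₊ : ℝ≥0) : ℝ) := NNReal.coe_le_coe.2 hx
        have h' : ((‖H i x‖₊ : ℝ≥0) : ℝ) = H i x := by
          rw [coe_nnnorm, Real.norm_eq_abs, abs_of_nonneg h0]
        rw [h'] at h
        exact h
      have hHpos : 0 < H i x := hC0.trans_le hCH
      calc H i x = H i x ^ (1 - r) * H i x ^ r := by
            rw [← Real.rpow_add hHpos]; simp
        _ ≤ C ^ (1 - r) * B i x ^ r := by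
            refine mul_le_mul (Real.rpow_le_rpow_of_nonpos hC0 hCH (by linarith))
              (Real.rpow_le_rpow h0 hB (by linarith)) (Real.rpow_nonneg h0 _) (Real.rpow_nonneg hC0.le _)
    · rw [indicator_of_notMem hx, enorm_zero]
      exact bot_le
  calc ∫⁻ x, ‖{x | (⟨C, hC0.le⟩ : ℝ≥0) ≤ ‖H i x‖₊}.indicator (H i) x‖ₑ ∂P
      ≤ ∫⁻ x, ENNReal.ofReal (C ^ (1 - r)) * ENNReal.ofReal (B i x ^ r) ∂P := lintegral_mono_ae hpt
    _ = ENNReal.ofReal (C ^ (1 - r)) * ∫⁻ x, ENNReal.ofReal (B i x ^ r) ∂P := lintegral_const_mul' _ _ ENNReal.ofReal_ne_top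
    _ ≤ ENNReal.ofReal (C ^ (1 - r)) * ENNReal.ofReal M := mul_le_mul_right (hB' i) _
    _ = ENNReal.ofReal (C ^ (1 - r) * M) := (ENNReal.ofReal_mul (Real.rpow_nonneg hC0.le _)).symm
    _ ≤ ENNReal.ofReal e := ENNReal.ofReal_le_ofReal hCM

/-! ### Pointwise convergence of the Lindhard integrand off the level sets -/

/-- **The Lindhard integrand `F_μ(q, p)` is continuous in `(μ, q)` at `(μ₀, q₀)` whenever
`ε p ≠ μ₀` and `ε (p + q₀) ≠ μ₀`** (the two occupations freeze near `(μ₀, q₀)`; the denominator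
`ε(p+q) - ε p` is continuous and non-zero when the occupations differ). [folklore] -/
theorem tendsto_lindhardIntegrand {ε : Momentum → ℝ} (hε : Continuous ε) {ι : Type*} {l : Filter ι}
    {μs : ι → ℝ} {qs : ι → Momentum} {μ₀ : ℝ} {q₀ p : Momentum}
    (hμ : Tendsto μs l (𝓝 μ₀)) (hq : Tendsto qs l (𝓝 q₀)) (hp : ε p ≠ μ₀) (hpq : ε (p + q₀) ≠ μ₀) :
    Tendsto (fun i => lindhardIntegrand ε (μs i) (qs i) p) l (𝓝 (lindhardIntegrand ε μ₀ q₀ p)) := by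
  have hE : Tendsto (fun i => ε (p + qs i)) l (𝓝 (ε (p + q₀))) :=
    (hε.tendsto _).comp (tendsto_const_nhds.add hq)
  -- the occupation of `p` freezes
  have hocc1 : ∀ᶠ i in l, fermiOccupation ε (μs i) p = fermiOccupation ε μ₀ p := by
    rcases lt_or_gt_of_ne hp with h | h
    · filter_upwards [hμ.eventually (lt_mem_nhds h)] with i hi
      simp [fermiOccupation, h, hi]
    · filter_upwards [hμ.eventually (gt_mem_nhds h)] with i hi
      simp [fermiOccupation, not_lt.2 h.le, not_lt.2 hi.le]
  -- the occupation of `p + q` freezes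
  have hocc2 : ∀ᶠ i in l, fermiOccupation ε (μs i) (p + qs i) = fermiOccupation ε μ₀ (p + q₀) := by
    have hD : Tendsto (fun i => ε (p + qs i) - μs i) l (𝓝 (ε (p + q₀) - μ₀)) := hE.sub hμ
    rcases lt_or_gt_of_ne hpq with h | h
    · filter_upwards [hD.eventually (gt_mem_nhds (sub_neg.2 h))] with i hi
      have hi' : ε (p + qs i) < μs i := sub_neg.1 hi
      simp [fermiOccupation, h, hi']
    · filter_upwards [hD.eventually (lt_mem_nhds (sub_pos.2 h))] with i hi
      have hi' : ¬ε (p + qs i) < μs i := not_lt.2 (sub_pos.1 hi).le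
      simp [fermiOccupation, not_lt.2 h.le, hi']
  by_cases hc : fermiOccupation ε μ₀ p = fermiOccupation ε μ₀ (p + q₀)
  · have hlim : lindhardIntegrand ε μ₀ q₀ p = 0 := by simp [lindhardIntegrand, hc]
    rw [hlim]
    refine tendsto_const_nhds.congr' ?_
    filter_upwards [hocc1, hocc2] with i h1 h2
    show (0 : ℝ) = lindhardIntegrand ε (μs i) (qs i) p
    simp only [lindhardIntegrand, h1, h2, hc, if_true]
  · have hden : ε (p + q₀) - ε p ≠ 0 := by
      intro h0
      apply hc
      have : ε (p + q₀) = ε p := sub_eq_zero.1 h0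
      simp [fermiOccupation, this]
    have hval : lindhardIntegrand ε μ₀ q₀ p =
        (fermiOccupation ε μ₀ p - fermiOccupation ε μ₀ (p + q₀)) / (ε (p + q₀) - ε p) := by
      simp only [lindhardIntegrand, hc, if_false]
    have hT : Tendsto (fun i => (fermiOccupation ε μ₀ p - fermiOccupation ε μ₀ (p + q₀)) / (ε (p + qs i) - ε p)) l
        (𝓝 ((fermiOccupation ε μ₀ p - fermiOccupation ε μ₀ (p + q₀)) / (ε (p + q₀) - ε p))) :=
      tendsto_const_nhds.div (hE.sub tendsto_const_nhds) hden
    rw [hval]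
    refine hT.congr' ?_
    filter_upwards [hocc1, hocc2] with i h1 h2
    show _ = lindhardIntegrand ε (μs i) (qs i) p
    simp only [lindhardIntegrand, h1, h2, hc, if_false]

/-! ### A.e. integrability of the `p`-sections and Minkowski on the difference -/

section Band

variable {μ : ℝ} (hμ₁ : -4 < μ) (hμ₂ : μ < 0)
include hμ₁ hμ₂

/-- **For a.e. `(θ, θ')` the `p`-section `p ↦ F_μ(γθ + γθ', p)` is integrable over the Brillouin
zone**, given (TSL) and (SV) at `μ` (Minkowski in `lintegral` form: `‖∫ F dp‖_{L²(dz)} < ∞`, so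
`∫ F dp < ∞` a.e.). [folklore] -/
theorem ae_integrableOn_lindhardIntegrand_polar {C β Csh : ℝ} (hC : 0 ≤ C) (hβ0 : 0 < β) (hβ2 : β < 2)
    (hCsh : 0 ≤ Csh)
    (hTSL : ∀ (p : Momentum) (s : ℝ), 0 < s →
      ((volume.restrict (Ioc (-π) π)).prod (volume.restrict (Ioc (-π) π)))
        {z : ℝ × ℝ | |squareDispersion 1 0 (p + (fermiPolar μ z.1 + fermiPolar μ z.2)) - μ| < s} ≤
        ENNReal.ofReal (C * s ^ β))
    (hSV : ∀ t : ℝ, 0 < t →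
      volume (brillouinZone ∩ {p : Momentum | |squareDispersion 1 0 p - μ| < t}) ≤ ENNReal.ofReal (Csh * t)) :
    ∀ᵐ z : ℝ × ℝ ∂((volume.restrict (Ioc (-π) π)).prod (volume.restrict (Ioc (-π) π))),
      IntegrableOn (fun p => lindhardIntegrand (squareDispersion 1 0) μ (fermiPolar μ z.1 + fermiPolar μ z.2) p)
        brillouinZone volume := by
  set ν : Measure (ℝ × ℝ) := (volume.restrict (Ioc (-π) π)).prod (volume.restrict (Ioc (-π) π)) with hν
  set P : Measure Momentum := volume.restrict brillouinZone with hP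
  set Φ : ℝ × ℝ → Momentum → ℝ≥0∞ := fun z p =>
    ENNReal.ofReal (lindhardIntegrand (squareDispersion 1 0) μ (fermiPolar μ z.1 + fermiPolar μ z.2) p) with hΦ
  have hΦm : Measurable (Function.uncurry Φ) :=
    ENNReal.measurable_ofReal.comp (measurable_lindhardIntegrand_polar hμ₁ hμ₂)
  have hMink := Literature.Analysis.FunctionSpaces.rpow_inv_lintegral_rpow_lintegral_le
    (μ := ν) (ν := P) (p := (2 : ℝ)) (by norm_num) hΦm
  have hRHS : ∫⁻ p, (∫⁻ z, Φ z p ^ (2 : ℝ) ∂ν) ^ (1 / (2 : ℝ)) ∂P =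
      ∫⁻ p, eLpNorm (fun z : ℝ × ℝ =>
        lindhardIntegrand (squareDispersion 1 0) μ (fermiPolar μ z.1 + fermiPolar μ z.2) p) 2 ν ∂P := by
    refine lintegral_congr fun p => ?_
    rw [eLpNorm_eq_lintegral_rpow_enorm_toReal two_ne_zero ENNReal.ofNat_ne_top, ENNReal.toReal_ofNat]
    congr 1
    refine lintegral_congr fun z => ?_
    rw [hΦ, Real.enorm_eq_ofReal (lindhardIntegrand_nonneg _ _ _ _)]
  have hfin : (∫⁻ z, (∫⁻ p, Φ z p ∂P) ^ (2 : ℝ) ∂ν) ^ (1 / (2 : ℝ)) < ⊤ :=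
    (hMink.trans_eq hRHS).trans_lt
      (lintegral_eLpNorm_lindhardIntegrand_polar_lt_top hμ₁ hμ₂ hC hβ0 hβ2 hCsh hTSL hSV)
  have hfin2 : ∫⁻ z, (∫⁻ p, Φ z p ∂P) ^ (2 : ℝ) ∂ν < ⊤ := by
    by_contra h
    rw [not_lt, top_le_iff] at h
    rw [h, ENNReal.top_rpow_of_pos (by norm_num)] at hfin
    exact lt_irrefl _ hfin
  have hGm : Measurable fun z => ∫⁻ p, Φ z p ∂P := hΦm.lintegral_prod_right
  have hae : ∀ᵐ z ∂ν, (∫⁻ p, Φ z p ∂P) ^ (2 : ℝ) < ⊤ := ae_lt_top (hGm.pow_const _) hfin2.ne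
  filter_upwards [hae] with z hz
  have hz' : ∫⁻ p, Φ z p ∂P < ⊤ := by
    by_contra h
    rw [not_lt, top_le_iff] at h
    rw [h, ENNReal.top_rpow_of_pos (by norm_num)] at hz
    exact lt_irrefl _ hz
  have hsec := (measurable_lindhardIntegrand_polar hμ₁ hμ₂).comp
    ((measurable_const (a := z)).prodMk (measurable_id (α := Momentum)))
  refine ⟨hsec.aestronglyMeasurable, ?_⟩
  show ∫⁻ p, ‖lindhardIntegrand (squareDispersion 1 0) μ (fermiPolar μ z.1 + fermiPolar μ z.2) p‖ₑ ∂P < ⊤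
  calc ∫⁻ p, ‖lindhardIntegrand (squareDispersion 1 0) μ (fermiPolar μ z.1 + fermiPolar μ z.2) p‖ₑ ∂P
      = ∫⁻ p, Φ z p ∂P := lintegral_congr fun p => Real.enorm_eq_ofReal (lindhardIntegrand_nonneg _ _ _ _)
    _ < ⊤ := hz'

end Band

/-- **Minkowski on the difference of two polar Lindhard kernels**:
`‖χ₀(γ_μ· + γ_μ·; μ) - χ₀(γ_μ'· + γ_μ'·; μ')‖_{L²(dz)} ≤ (2π)⁻² ∫_{BZ} ‖F_μ(·, p) - F_μ'(·, p)‖_{L²(dz)} dp`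
(both levels in the band, (TSL)+(SV) at both, so that the `p`-sections are a.e. integrable and the
difference of the integrals is the integral of the difference). [cite: SteinSingularIntegrals1970, App. A.1] -/
theorem eLpNorm_lindhardKernelPolar_sub_le {μ μ' : ℝ} (hμ₁ : -4 < μ) (hμ₂ : μ < 0) (hμ'₁ : -4 < μ') (hμ'₂ : μ' < 0)
    {C β Csh C' β' Csh' : ℝ} (hC : 0 ≤ C) (hβ0 : 0 < β) (hβ2 : β < 2) (hCsh : 0 ≤ Csh)
    (hC' : 0 ≤ C') (hβ'0 : 0 < β') (hβ'2 : β' < 2) (hCsh' : 0 ≤ Csh')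
    (hTSL : ∀ (p : Momentum) (s : ℝ), 0 < s →
      ((volume.restrict (Ioc (-π) π)).prod (volume.restrict (Ioc (-π) π)))
        {z : ℝ × ℝ | |squareDispersion 1 0 (p + (fermiPolar μ z.1 + fermiPolar μ z.2)) - μ| < s} ≤
        ENNReal.ofReal (C * s ^ β))
    (hSV : ∀ t : ℝ, 0 < t →
      volume (brillouinZone ∩ {p : Momentum | |squareDispersion 1 0 p - μ| < t}) ≤ ENNReal.ofReal (Csh * t))
    (hTSL' : ∀ (p : Momentum) (s : ℝ), 0 < s →
      ((volume.restrict (Ioc (-π) π)).prod (volume.restrict (Ioc (-π) π)))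
        {z : ℝ × ℝ | |squareDispersion 1 0 (p + (fermiPolar μ' z.1 + fermiPolar μ' z.2)) - μ'| < s} ≤
        ENNReal.ofReal (C' * s ^ β'))
    (hSV' : ∀ t : ℝ, 0 < t →
      volume (brillouinZone ∩ {p : Momentum | |squareDispersion 1 0 p - μ'| < t}) ≤ ENNReal.ofReal (Csh' * t)) :
    eLpNorm (fun z : ℝ × ℝ =>
        lindhardFunction (squareDispersion 1 0) μ (fermiPolar μ z.1 + fermiPolar μ z.2) -
        lindhardFunction (squareDispersion 1 0) μ' (fermiPolar μ' z.1 + fermiPolar μ' z.2)) 2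
      ((volume.restrict (Ioc (-π) π)).prod (volume.restrict (Ioc (-π) π))) ≤
    ENNReal.ofReal (((2 * π) ^ 2)⁻¹) * ∫⁻ p in brillouinZone, eLpNorm (fun z : ℝ × ℝ =>
        lindhardIntegrand (squareDispersion 1 0) μ (fermiPolar μ z.1 + fermiPolar μ z.2) p -
        lindhardIntegrand (squareDispersion 1 0) μ' (fermiPolar μ' z.1 + fermiPolar μ' z.2) p) 2
      ((volume.restrict (Ioc (-π) π)).prod (volume.restrict (Ioc (-π) π))) := by
  set ν : Measure (ℝ × ℝ) := (volume.restrict (Ioc (-π) π)).prod (volume.restrict (Ioc (-π) π)) with hν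
  set P : Measure Momentum := volume.restrict brillouinZone with hP
  have h1 := ae_integrableOn_lindhardIntegrand_polar hμ₁ hμ₂ hC hβ0 hβ2 hCsh hTSL hSV
  have h2 := ae_integrableOn_lindhardIntegrand_polar hμ'₁ hμ'₂ hC' hβ'0 hβ'2 hCsh' hTSL' hSV'
  set G : ℝ × ℝ → ℝ := fun z => ∫ p in brillouinZone,
    (lindhardIntegrand (squareDispersion 1 0) μ (fermiPolar μ z.1 + fermiPolar μ z.2) p -
      lindhardIntegrand (squareDispersion 1 0) μ' (fermiPolar μ' z.1 + fermiPolar μ' z.2) p) with hG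
  have hae : (fun z : ℝ × ℝ =>
        lindhardFunction (squareDispersion 1 0) μ (fermiPolar μ z.1 + fermiPolar μ z.2) -
        lindhardFunction (squareDispersion 1 0) μ' (fermiPolar μ' z.1 + fermiPolar μ' z.2)) =ᵐ[ν]
      (((2 * π) ^ 2)⁻¹ : ℝ) • G := by
    filter_upwards [h1, h2] with z hz1 hz2
    simp only [Pi.smul_apply, smul_eq_mul, hG, lindhardFunction]
    rw [integral_sub hz1 hz2, div_sub_div_same, div_eq_inv_mul]
  rw [eLpNorm_congr_ae hae, eLpNorm_const_smul, Real.enorm_eq_ofReal (by positivity)]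
  have hF : AEStronglyMeasurable (Function.uncurry fun (z : ℝ × ℝ) (p : Momentum) =>
      lindhardIntegrand (squareDispersion 1 0) μ (fermiPolar μ z.1 + fermiPolar μ z.2) p -
      lindhardIntegrand (squareDispersion 1 0) μ' (fermiPolar μ' z.1 + fermiPolar μ' z.2) p) (ν.prod P) :=
    ((measurable_lindhardIntegrand_polar hμ₁ hμ₂).sub
      (measurable_lindhardIntegrand_polar hμ'₁ hμ'₂)).aestronglyMeasurable
  have hMink := Literature.Analysis.FunctionSpaces.eLpNorm_integral_le_lintegral_eLpNorm hF (p := 2)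
    (by norm_num) ENNReal.ofNat_ne_top
  exact mul_le_mul_right hMink _

/-! ### A.e.-`p` convergence of the sections in `L²(dz)` -/

/-- Bounded convergence in `L²` of a finite measure: measurable `D_n`, eventually uniformly bounded,
`D_n → 0` a.e. `⟹ ‖D_n‖_{L²} → 0`. [folklore] -/
theorem tendsto_eLpNorm_two_of_abs_le_of_tendsto_ae {α : Type*} [MeasurableSpace α] {ν : Measure α}
    [IsFiniteMeasure ν] {D : ℕ → α → ℝ} (hDm : ∀ n, Measurable (D n)) {M : ℝ}
    (hbd : ∀ᶠ n in atTop, ∀ z, |D n z| ≤ M) (hlim : ∀ᵐ z ∂ν, Tendsto (fun n => D n z) atTop (𝓝 0)) :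
    Tendsto (fun n => eLpNorm (D n) 2 ν) atTop (𝓝 0) := by
  have key : Tendsto (fun n => ∫⁻ z, ‖D n z‖ₑ ^ (2 : ℝ) ∂ν) atTop (𝓝 (∫⁻ _z : α, (0 : ℝ≥0∞) ∂ν)) := by
    refine tendsto_lintegral_filter_of_dominated_convergence (fun _ => ENNReal.ofReal (M ^ 2))
      (Eventually.of_forall fun n => (hDm n).enorm.pow_const _) ?_ ?_ ?_
    · filter_upwards [hbd] with n hn
      refine Eventually.of_forall fun z => ?_
      rw [Real.enorm_eq_ofReal_abs, ENNReal.ofReal_rpow_of_nonneg (abs_nonneg _) (by norm_num), Real.rpow_two]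
      exact ENNReal.ofReal_le_ofReal (pow_le_pow_left₀ (abs_nonneg _) (hn z) 2)
    · rw [lintegral_const]
      exact ENNReal.mul_ne_top ENNReal.ofReal_ne_top (measure_ne_top ν _)
    · filter_upwards [hlim] with z hz
      have henorm : Tendsto (fun n => ‖D n z‖ₑ) atTop (𝓝 0) := by
        have h := (continuous_enorm.tendsto (0 : ℝ)).comp hz
        rwa [enorm_zero] at h
      have h2 := ((ENNReal.continuous_rpow_const (y := (2 : ℝ))).tendsto 0).comp henorm
      rwa [ENNReal.zero_rpow_of_pos (by norm_num)] at h2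
  rw [lintegral_zero] at key
  have h2 : ∀ n, eLpNorm (D n) 2 ν = (∫⁻ z, ‖D n z‖ₑ ^ (2 : ℝ) ∂ν) ^ (1 / (2 : ℝ)) := fun n => by
    rw [eLpNorm_eq_lintegral_rpow_enorm_toReal two_ne_zero ENNReal.ofNat_ne_top, ENNReal.toReal_ofNat]
  simp_rw [h2]
  have h3 := ((ENNReal.continuous_rpow_const (y := 1 / (2 : ℝ))).tendsto 0).comp key
  rwa [ENNReal.zero_rpow_of_pos (by norm_num)] at h3

/-- The level `μ₀` sum-set `{(θ,θ') | ε(p + γ₀θ + γ₀θ') = μ₀}` is null, given (TSL) at `μ₀`. [folklore] -/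
theorem measure_sumLevelSet_eq_zero {μ₀ : ℝ} {C β : ℝ} (hβ0 : 0 < β) (p : Momentum)
    (hTSL₀ : ∀ s : ℝ, 0 < s →
      ((volume.restrict (Ioc (-π) π)).prod (volume.restrict (Ioc (-π) π)))
        {z : ℝ × ℝ | |squareDispersion 1 0 (p + (fermiPolar μ₀ z.1 + fermiPolar μ₀ z.2)) - μ₀| < s} ≤
        ENNReal.ofReal (C * s ^ β)) :
    ((volume.restrict (Ioc (-π) π)).prod (volume.restrict (Ioc (-π) π)))
      {z : ℝ × ℝ | squareDispersion 1 0 (p + (fermiPolar μ₀ z.1 + fermiPolar μ₀ z.2)) = μ₀} = 0 := by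
  refine le_antisymm ?_ bot_le
  have hg : Tendsto (fun s : ℝ => ENNReal.ofReal (C * s ^ β)) (𝓝[>] 0) (𝓝 0) := by
    have h0 : Tendsto (fun s : ℝ => C * s ^ β) (𝓝 0) (𝓝 (C * (0 : ℝ) ^ β)) :=
      ((Real.continuous_rpow_const hβ0.le).tendsto 0).const_mul C
    rw [Real.zero_rpow hβ0.ne', mul_zero] at h0
    have h1 := ENNReal.tendsto_ofReal (h0.mono_left (nhdsWithin_le_nhds (s := Ioi (0 : ℝ))))
    rwa [ENNReal.ofReal_zero] at h1
  refine ge_of_tendsto hg ?_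
  filter_upwards [self_mem_nhdsWithin] with s hs
  refine (measure_mono fun z hz => ?_).trans (hTSL₀ s hs)
  simp only [mem_setOf_eq] at hz ⊢
  rw [hz, sub_self, abs_zero]
  exact hs

/-- Along a sequence of band levels `μ_n → μ₀ ∈ (-4, 0)`, `γ_{μ_n}θ + γ_{μ_n}θ' → γ_{μ₀}θ + γ_{μ₀}θ'`
(joint continuity of the polar point). [folklore] -/
theorem tendsto_fermiPolar_sum {μ₀ : ℝ} (h₁ : -4 < μ₀) (h₂ : μ₀ < 0) {μs : ℕ → ℝ}
    (hlim : Tendsto μs atTop (𝓝 μ₀)) (z : ℝ × ℝ) :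
    Tendsto (fun n => fermiPolar (μs n) z.1 + fermiPolar (μs n) z.2) atTop
      (𝓝 (fermiPolar μ₀ z.1 + fermiPolar μ₀ z.2)) := by
  have hc : ∀ θ : ℝ, Tendsto (fun n => fermiPolar (μs n) θ) atTop (𝓝 (fermiPolar μ₀ θ)) := fun θ => by
    have hmem : Ioo (-4 : ℝ) 0 ×ˢ (univ : Set ℝ) ∈ 𝓝 ((μ₀, θ) : ℝ × ℝ) :=
      (isOpen_Ioo.prod isOpen_univ).mem_nhds ⟨⟨h₁, h₂⟩, mem_univ _⟩
    have hcont : ContinuousAt (fun q : ℝ × ℝ => fermiPolar q.1 q.2) (μ₀, θ) :=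
      continuousOn_fermiPolar_uncurry.continuousAt hmem
    have hpair : Tendsto (fun n => (μs n, θ)) atTop (𝓝 (μ₀, θ)) := hlim.prodMk_nhds tendsto_const_nhds
    have h := hcont.tendsto.comp hpair
    exact h
  exact (hc z.1).add (hc z.2)

/-- **For `p` off the level set `{ε = μ₀}`, `‖F_{μ_n}(·, p) - F_{μ₀}(·, p)‖_{L²(dz)} → 0`** along any
sequence `μ_n → μ₀` in the band, given (TSL) at `μ₀` (which makes `{z | ε(p + γ₀θ + γ₀θ') = μ₀}`
null): bounded convergence in `z` with the constant bound `3/|ε_p - μ₀|`, the integrand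
converging pointwise off that null set by `tendsto_lindhardIntegrand`. [folklore] -/
theorem tendsto_eLpNorm_lindhardIntegrand_polar_sub {μ₀ : ℝ} (h₁ : -4 < μ₀) (h₂ : μ₀ < 0) {C β : ℝ}
    (hβ0 : 0 < β)
    (hTSL₀ : ∀ (p : Momentum) (s : ℝ), 0 < s →
      ((volume.restrict (Ioc (-π) π)).prod (volume.restrict (Ioc (-π) π)))
        {z : ℝ × ℝ | |squareDispersion 1 0 (p + (fermiPolar μ₀ z.1 + fermiPolar μ₀ z.2)) - μ₀| < s} ≤
        ENNReal.ofReal (C * s ^ β))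
    {μs : ℕ → ℝ} (hband : ∀ n, μs n ∈ Ioo (-4 : ℝ) 0) (hlim : Tendsto μs atTop (𝓝 μ₀))
    {p : Momentum} (hp : squareDispersion 1 0 p ≠ μ₀) :
    Tendsto (fun n => eLpNorm (fun z : ℝ × ℝ =>
        lindhardIntegrand (squareDispersion 1 0) (μs n) (fermiPolar (μs n) z.1 + fermiPolar (μs n) z.2) p -
        lindhardIntegrand (squareDispersion 1 0) μ₀ (fermiPolar μ₀ z.1 + fermiPolar μ₀ z.2) p) 2
      ((volume.restrict (Ioc (-π) π)).prod (volume.restrict (Ioc (-π) π)))) atTop (𝓝 0) := by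
  have hε : Continuous (squareDispersion 1 0) := by unfold squareDispersion; fun_prop
  have ha₀ : 0 < |squareDispersion 1 0 p - μ₀| := abs_pos.2 (sub_ne_zero.2 hp)
  refine tendsto_eLpNorm_two_of_abs_le_of_tendsto_ae (M := 3 / |squareDispersion 1 0 p - μ₀|)
    (fun n => ?_) ?_ ?_
  · -- measurability of `D_n`
    have ha := (measurable_lindhardIntegrand_polar (hband n).1 (hband n).2).comp
      (measurable_id.prodMk (measurable_const (a := p)))
    have hb := (measurable_lindhardIntegrand_polar h₁ h₂).comp
      (measurable_id.prodMk (measurable_const (a := p)))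
    exact ha.sub hb
  · -- the uniform bound, for `n` with `|μ_n - μ₀| < a₀/2`
    have hev : ∀ᶠ n in atTop, |μs n - μ₀| < |squareDispersion 1 0 p - μ₀| / 2 := by
      have h := hlim.eventually (Metric.ball_mem_nhds μ₀ (half_pos ha₀))
      filter_upwards [h] with n hn
      have hn' : dist (μs n) μ₀ < |squareDispersion 1 0 p - μ₀| / 2 := hn
      rwa [Real.dist_eq] at hn'
    filter_upwards [hev] with n hn
    intro z
    have hFn : lindhardIntegrand (squareDispersion 1 0) (μs n)
        (fermiPolar (μs n) z.1 + fermiPolar (μs n) z.2) p ≤ 2 / |squareDispersion 1 0 p - μ₀| := by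
      refine ((lindhardIntegrand_le_inv _ _ _ _).trans_eq (one_div _)).trans ?_
      have han : |squareDispersion 1 0 p - μ₀| / 2 ≤ |squareDispersion 1 0 p - μs n| := by
        have : |squareDispersion 1 0 p - μ₀| ≤ |squareDispersion 1 0 p - μs n| + |μs n - μ₀| := by
          calc |squareDispersion 1 0 p - μ₀|
              = |(squareDispersion 1 0 p - μs n) + (μs n - μ₀)| := by ring_nf
            _ ≤ _ := abs_add_le _ _
        linarith
      calc (|squareDispersion 1 0 p - μs n| +
            |squareDispersion 1 0 (p + (fermiPolar (μs n) z.1 + fermiPolar (μs n) z.2)) - μs n|)⁻¹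
          ≤ (|squareDispersion 1 0 p - μs n|)⁻¹ :=
            inv_anti₀ (by linarith) (le_add_of_nonneg_right (abs_nonneg _))
        _ ≤ (|squareDispersion 1 0 p - μ₀| / 2)⁻¹ := inv_anti₀ (by positivity) han
        _ = 2 / |squareDispersion 1 0 p - μ₀| := by rw [inv_div]
    have hF0 : lindhardIntegrand (squareDispersion 1 0) μ₀ (fermiPolar μ₀ z.1 + fermiPolar μ₀ z.2) p ≤
        1 / |squareDispersion 1 0 p - μ₀| := by
      refine ((lindhardIntegrand_le_inv _ _ _ _).trans_eq (one_div _)).trans ?_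
      rw [one_div]
      exact inv_anti₀ ha₀ (le_add_of_nonneg_right (abs_nonneg _))
    have h0n := lindhardIntegrand_nonneg (squareDispersion 1 0) (μs n)
      (fermiPolar (μs n) z.1 + fermiPolar (μs n) z.2) p
    have h00 := lindhardIntegrand_nonneg (squareDispersion 1 0) μ₀ (fermiPolar μ₀ z.1 + fermiPolar μ₀ z.2) p
    have h3 : 2 / |squareDispersion 1 0 p - μ₀| + 1 / |squareDispersion 1 0 p - μ₀| =
        3 / |squareDispersion 1 0 p - μ₀| := by ring
    rw [abs_sub_le_iff]
    constructor <;> linarith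
  · -- pointwise convergence off the null set `{ε(p + γ₀θ + γ₀θ') = μ₀}`
    have hae : ∀ᵐ z : ℝ × ℝ ∂((volume.restrict (Ioc (-π) π)).prod (volume.restrict (Ioc (-π) π))),
        squareDispersion 1 0 (p + (fermiPolar μ₀ z.1 + fermiPolar μ₀ z.2)) ≠ μ₀ :=
      measure_eq_zero_iff_ae_notMem.1 (measure_sumLevelSet_eq_zero hβ0 p (hTSL₀ p))
    filter_upwards [hae] with z hz
    have hF := tendsto_lindhardIntegrand hε hlim (tendsto_fermiPolar_sum h₁ h₂ hlim z) hp hz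
    have h := hF.sub (tendsto_const_nhds
      (x := lindhardIntegrand (squareDispersion 1 0) μ₀ (fermiPolar μ₀ z.1 + fermiPolar μ₀ z.2) p))
    rwa [sub_self] at h

end Literature.MathematicalPhysics.QuantumLattice

end
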